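import Mathlib.Analysis.SpecialFunctions.Trigonometric.Chebyshev.RootsExtrema
import Mathlib.Analysis.SpecialFunctions.Trigonometric.Bounds
import Mathlib.RingTheory.Polynomial.Chebyshev
import Literature.Computability.AlgebraicComplexity.TauConjecture
import Literature.Computability.AlgebraicComplexity.ConstantFreeCircuits
import Literature.Computability.AlgebraicComplexity.RazElusiveGeneralProofs
import HarnessLib

/-!
# Barrier catalogue `ValiantsHypothesis`: real-zero counting cannot prove the τ-conjecture
(Chebyshev polynomials: `τ(T_{2^k}) = O(k)` but `2^k` distinct real zeros)

D-0021 barrier entry for the summit `ValiantsHypothesis` (`VP ≠ VNP`), bearing on the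
constant-free route `ValiantsHypothesis/TauConst` (tree: `CplxAlg.ShubSmaleTauConjecture`, and the
named fact `CplxAlg.not_isPBounded_constantFreeComplexity_perPoly_of_tauConjecture` = Bürgisser 2009,
Main Thm. 1.2: the τ-conjecture implies that `τ(PER_n)` is not polynomially bounded, i.e. the
constant-free form of Valiant's hypothesis; survey statement "The τ-conjecture implies
`VP⁰ ≠ VNP⁰`" [Burgisser2024Completeness, §4.6, Thm. 4.17]).

**The printed obstruction** (checked with `lit read`).

* Koiran, ICS 2011 (arXiv:1004.4960v4), §1, p. 3 of the arXiv version: "Our strongest version of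
  the τ-conjecture raises the intriguing possibility that tools from real analysis might be
  brought to bear on this problem (a bound on the number of real roots of a polynomial is a
  fortiori a bound on its number of integer roots). It is known that this approach cannot work
  for the original τ-conjecture because the number of real roots of a univariate polynomial can
  grow exponentially as a function of its arithmetic circuit size: Chebyshev polynomials provide
  such an example [SmaleProblems]. A similar example was provided earlier by Borodin and Cook
  [BC76]". (The bracketed references are Koiran's: Smale, *Mathematical problems for the next
  century*, 2000, and Borodin–Cook 1976; neither is held, and nothing is cited from them here.)
* Bürgisser, *Completeness classes in algebraic complexity theory* (2024), §4.6 "Tau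
  Conjectures": the τ-conjecture "`z(f) ≤ (1 + τ(f))^c`" for the number `z(f)` of distinct
  integer roots of a nonzero `f ∈ ℤ[x]`; "The τ-conjecture is false when replacing "integer
  zeros" by "real zeros". Koiran observed that when restricting to polynomials given by
  depth-four circuits, an analogous conjecture bounding real zeros has the same dramatic
  consequences." (Conjecture 4.1 there = tree `CplxAlg.KoiranRealTauConjecture`.)

**What this file does (everything PROVED).** With `τ` rendered, exactly as in
`Literature.Computability.AlgebraicComplexity.TauConjecture`, by the tree's constant-free
fan-in-two gate count `CplxAlg.constantFreeComplexity` of the image of `f ∈ ℤ[X]` in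
`MvPolynomial (Fin 1) ℤ`:
* `chebyshevCircuit k`: the constant-free circuit `x ↦ T_2(T_2(⋯ T_2(x)))` (`k` times,
  `T_2(y) = 2y² - 1`, three gates per step: `y·y`, `y² + y²`, `2y² - 1`), computing the Chebyshev
  polynomial `T_{2^k}` (`eval_chebyshevCircuit`, via Mathlib's `T_mul`, `T_two`); hence
  `τ(T_{2^k}) ≤ 3k` (`constantFreeComplexity_chebyshevT_le`);
* `card_realRoots_chebyshevT`: `T_{2^k}` has exactly `2^k` distinct real zeros (Mathlib's
  `Polynomial.Chebyshev.roots_T_real`);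
* the technique class `RealZeroTauBound c` — a bound `≤ (τ(f) + 2)^c` on the number of distinct
  REAL zeros of every nonzero integer polynomial (the real-analysis strengthening of the
  τ-conjecture with exponent `c`; it implies the exponent-`c` τ-conjecture,
  `RealZeroTauBound.integerZeros`) — and the barrier `TauRealZeros : ∀ c, ¬ RealZeroTauBound c`,
  proved (`tauRealZeros_holds`): polynomial versus exponential growth at `f = T_{2^k}`.

**Barrier audit 2026-08-17 (D-0021): CONFIRMED and strengthened.** The printed obstruction was
re-read on the page (Koiran 2011, arXiv p. 3; Bürgisser 2024, §4.6, p. 20: "The τ-conjecture is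
false when replacing "integer zeros" by "real zeros""; Bürgisser–Clausen–Shokrollahi 1997, Ch. 12:
Thm. (12.12) of Grigoriev–Risler `¼√(log N) ≤ L⁺(f)` for `N` real zeros, Ex. (12.13) `T_{3^r}`,
Problem 12.3 "the Chebyshev polynomials … show that this [`L⁺(f) ≥ c log N`] is the best result of
its kind which can be expected"; Phillipson–Rojas 2013, Ex. 1.10: the conjugate logistic family
`h_{n+1} = 4h_n(1 - h_n)`, `2^n` real roots of `h_n - x` in `(0,1)` at `τ = O(n)`). The audit found
the FORMAL class `RealZeroTauBound` narrower than the printed obstruction in two inessential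
respects and closes both (everything proved, appended below the original barrier):
* growth rates — `two_pow_le_of_realZeroBound` / `not_realZeroBound_of_lt_two_pow`: any monotone
  bound `z_ℝ(f) ≤ F(τ(f))` forces `2^k ≤ F(3k)`, so not only the polynomial shapes `(τ+2)^c` but
  every subexponential shape is excluded, in particular (`not_realZeroBound_quasipoly`) the
  quasi-polynomial shape `2^{(log₂(τ+2))^c}` — relevant because for SPS polynomials a bound
  `q(s) ≤ 2^{(log s)^{1+c}}` "would still be strong enough to conclude that the permanent is not
  in VP⁰" (Koiran 2011, §6, p. 11);
* metric separation — `SeparatedRealZeroTauBound c` (bound only sets of real zeros pairwise at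
  distance `≥ 1`, as integer zeros are; wider than `RealZeroTauBound c`, still implying the
  τ-conjecture) is refuted for every `c` (`not_separatedRealZeroTauBound`) by the integer DILATION
  `E_{k,k} = a^{2^k} D_{2^k}(X/a)`, `a = 2^{2^k}`, of the Dickson/Chebyshev recurrence
  (`dilDickson`: monic, `τ ≤ k(2k+7)`, `2^k` real zeros `2a cos((2i+1)π/2^{k+1})` pairwise `≥ 1`
  apart). So integrality must enter arithmetically, not as spacing.
Documented evasions added to the catalogue entry: the adelic τ-conjecture of Phillipson–Rojas
(let the place `L ∈ {ℝ, ℚ₂, ℚ₃, …}` depend on `f`; each single place fails), besides the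
restricted-circuit-class conjectures already listed.

## References

* [Koiran2011] P. Koiran, *Shallow circuits with high-powered inputs*, ICS 2011, 309–320
  (arXiv:1004.4960v4), §1 (p. 3: the Chebyshev obstruction), §6 (Conj. 3, real τ-conjecture).
* [Burgisser2024Completeness] P. Bürgisser, *Completeness classes in algebraic complexity
  theory*, 2024 (arXiv:2406.06217), §4.6 (τ-conjecture, Thm. 4.17, "false when replacing integer
  zeros by real zeros", Conj. 4.1–4.2).
* [ShubSmale1995] M. Shub, S. Smale, Duke Math. J. 81 (1995) — the τ-conjecture (tree key; as
  cited in `TauConjecture.lean`).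
* [Burgisser2009] P. Bürgisser, Comput. Complexity 18 (2009), Main Thm. 1.2 (tree key).
* [BriquelBurgisser2020] I. Briquel, P. Bürgisser, *The real tau-conjecture is true on average*,
  Random Structures & Algorithms (2020), Thm. 1 (tree key).
* [PhillipsonRojas2013] K. Phillipson, J. M. Rojas, *Fewnomial systems with many roots, and an
  adelic tau conjecture*, in: Tropical and Non-Archimedean Geometry, Contemp. Math. 605 (2013)
  45–71 (arXiv:1011.4128), §1.2: Ex. 1.10 (logistic family), Lemma 1.11 (`p`-adic analogues),
  Adelic τ-Conjecture 1 (p. 6 of the arXiv version).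
* [BurgisserClausenShokrollahi1997] P. Bürgisser, M. Clausen, M. A. Shokrollahi, *Algebraic
  Complexity Theory*, Springer 1997, Ch. 12 "Additive Complexity": Thm. (12.12), Ex. (12.13),
  Problem 12.3, §12.6 Notes (Borodin–Cook, Grigoriev, Risler).
-/

noncomputable section

namespace Literature.Barriers.ValiantsHypothesis

open Polynomial Polynomial.Chebyshev MvPolynomial Literature.Computability.AlgebraicComplexity Literature.Computability.AlgebraicComplexity.ArithCircuit

/-! ### Two one-gate gadgets (sharing the argument, unlike `ArithCircuit.add`) -/

section Gadgets

variable {k : Type} {σ : Type}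

/-- The circuit computing `P.eval + P.eval`: `P` followed by one sum gate `1 • o + 1 • o` reading
`P`'s output twice (no duplication of `P`). [folklore] -/
def double [One k] (P : ArithCircuit k σ) : ArithCircuit k σ where
  gates := P.gates ++ [.sum [(1, P.output), (1, P.output)]]
  output := .gate P.size

/-- The circuit computing `P.eval - 1`: `P` followed by one sum gate `1 • o + (-1) • 1`. [folklore] -/
def subOne [Ring k] (P : ArithCircuit k σ) : ArithCircuit k σ where
  gates := P.gates ++ [.sum [(1, P.output), (-1, .const 1)]]
  output := .gate P.size

/-- `double` adds one gate. [folklore] -/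
@[simp]
theorem size_double [One k] (P : ArithCircuit k σ) : (double P).size = P.size + 1 := by
  simp [double, ArithCircuit.size]

/-- `subOne` adds one gate. [folklore] -/
@[simp]
theorem size_subOne [Ring k] (P : ArithCircuit k σ) : (subOne P).size = P.size + 1 := by
  simp [subOne, ArithCircuit.size]

/-- `double` preserves fan-in two (its new gate has two operands). [folklore] -/
theorem isFanInTwo_double [One k] {P : ArithCircuit k σ} (hP : P.IsFanInTwo) :
    (double P).IsFanInTwo := by
  intro g hg
  simp only [double, List.mem_append, List.mem_singleton] at hg
  rcases hg with hg | rfl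
  · exact hP g hg
  · simp [Gate.fanIn, Gate.args]

/-- `subOne` preserves fan-in two (its new gate has two operands). [folklore] -/
theorem isFanInTwo_subOne [Ring k] {P : ArithCircuit k σ} (hP : P.IsFanInTwo) :
    (subOne P).IsFanInTwo := by
  intro g hg
  simp only [subOne, List.mem_append, List.mem_singleton] at hg
  rcases hg with hg | rfl
  · exact hP g hg
  · simp [Gate.fanIn, Gate.args]

/-- `double` preserves sign constants (coefficients `1, 1`). [folklore] -/
theorem hasSignConstants_double [Zero k] [One k] [Add k] {P : ArithCircuit k σ}
    (hP : P.HasSignConstants) : (double P).HasSignConstants := by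
  refine ⟨fun g hg => ?_, trivial⟩
  simp only [double, List.mem_append, List.mem_singleton] at hg
  rcases hg with hg | rfl
  · exact hP.1 g hg
  · intro a ha
    simp only [List.mem_cons, List.mem_nil_iff, or_false] at ha
    rcases ha with rfl | rfl <;> exact ⟨isSignConstant_one, hP.2⟩

/-- `subOne` preserves sign constants (coefficients `1, -1`, constant `1`). [folklore] -/
theorem hasSignConstants_subOne [Ring k] {P : ArithCircuit k σ} (hP : P.HasSignConstants) :
    (subOne P).HasSignConstants := by
  refine ⟨fun g hg => ?_, trivial⟩
  simp only [subOne, List.mem_append, List.mem_singleton] at hg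
  rcases hg with hg | rfl
  · exact hP.1 g hg
  · intro a ha
    simp only [List.mem_cons, List.mem_nil_iff, or_false] at ha
    rcases ha with rfl | rfl
    · exact ⟨isSignConstant_one, hP.2⟩
    · exact ⟨isSignConstant_neg_one, isSignConstant_one⟩

variable [CommRing k]

/-- `double P` computes `P.eval + P.eval`. [folklore] -/
theorem eval_double (P : ArithCircuit k σ) : (double P).eval = P.eval + P.eval := by
  have h := gateValues_length (k := k) P.gates
  simp [ArithCircuit.eval, double, gateValues_append_singleton, Operand.eval, Gate.eval,
    ArithCircuit.size, List.getD_eq_getElem?_getD, h]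

/-- `subOne P` computes `P.eval - 1`. [folklore] -/
theorem eval_subOne (P : ArithCircuit k σ) : (subOne P).eval = P.eval - 1 := by
  have h := gateValues_length (k := k) P.gates
  simp [ArithCircuit.eval, subOne, gateValues_append_singleton, Operand.eval, Gate.eval,
    ArithCircuit.size, List.getD_eq_getElem?_getD, h, sub_eq_add_neg]

end Gadgets

/-! ### The Chebyshev circuits `T_{2^k} = T_2 ∘ ⋯ ∘ T_2` -/

/-- The constant-free circuit for `T_{2^k}`: start from the variable and apply `y ↦ 2y² - 1`
(`T_2`) `k` times, three gates per step. [cite: Koiran2011, §1 (p. 3)] -/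
def chebyshevCircuit : ℕ → ArithCircuit ℤ (Fin 1)
  | 0 => ofVar 0
  | k + 1 => subOne (double (chebyshevCircuit k).square)

/-- The Chebyshev polynomial `T_{2^k} ∈ ℤ[X]` viewed in `MvPolynomial (Fin 1) ℤ` (the rendering of
univariate polynomials used by `CplxAlg.ShubSmaleTauConjecture`). [cite: Koiran2011, §1 (p. 3)] -/
def chebyshevT (k : ℕ) : MvPolynomial (Fin 1) ℤ :=
  (MvPolynomial.uniqueAlgEquiv ℤ (Fin 1)).symm (T ℤ ((2 ^ k : ℕ) : ℤ))

/-- `chebyshevCircuit k` has exactly `3k` gates. [folklore] -/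
@[simp]
theorem size_chebyshevCircuit (k : ℕ) : (chebyshevCircuit k).size = 3 * k := by
  induction k with
  | zero => rfl
  | succ k ih => simp [chebyshevCircuit, ih]; ring

/-- `chebyshevCircuit k` has fan-in two. [folklore] -/
theorem isFanInTwo_chebyshevCircuit (k : ℕ) : (chebyshevCircuit k).IsFanInTwo := by
  induction k with
  | zero => exact IsFanInTwo.ofVar 0
  | succ k ih => exact isFanInTwo_subOne (isFanInTwo_double ih.square)

/-- `chebyshevCircuit k` is constant-free (all constants and coefficients in `{0, 1, -1}`). [folklore] -/
theorem hasSignConstants_chebyshevCircuit (k : ℕ) : (chebyshevCircuit k).HasSignConstants := by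
  induction k with
  | zero => exact HasSignConstants.ofVar 0
  | succ k ih => exact hasSignConstants_subOne (hasSignConstants_double ih.square)

/-- The doubling recurrence `T_{2^{k+1}} = 2 T_{2^k}² - 1` (`T_{2m} = T_2 ∘ T_m`, `T_2 = 2X² - 1`).
[folklore] -/
theorem chebyshevT_succ (k : ℕ) :
    chebyshevT (k + 1) = 2 * chebyshevT k ^ 2 - 1 := by
  unfold chebyshevT
  have h : T ℤ ((2 ^ (k + 1) : ℕ) : ℤ) = (T ℤ 2).comp (T ℤ ((2 ^ k : ℕ) : ℤ)) := by
    rw [← T_mul]; congr 1; push_cast; ring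
  have h2 : (T ℤ 2).comp (T ℤ ((2 ^ k : ℕ) : ℤ)) = 2 * T ℤ ((2 ^ k : ℕ) : ℤ) ^ 2 - 1 := by
    rw [T_two]
    simp only [sub_comp, mul_comp, pow_comp, X_comp, one_comp, Polynomial.ofNat_comp]
    norm_num
  rw [h, h2, map_sub, map_mul, map_pow, map_one, map_ofNat]

/-- `chebyshevT 0 = X 0` (`T_1 = X`). [folklore] -/
theorem chebyshevT_zero : chebyshevT 0 = X 0 := by
  unfold chebyshevT
  simp [MvPolynomial.uniqueAlgEquiv_symm_apply]

/-- `chebyshevCircuit k` computes `T_{2^k}`. [cite: Koiran2011, §1 (p. 3)] -/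
theorem eval_chebyshevCircuit (k : ℕ) : (chebyshevCircuit k).eval = chebyshevT k := by
  induction k with
  | zero => rw [chebyshevT_zero]; rfl
  | succ k ih =>
    simp only [chebyshevCircuit]
    rw [eval_subOne, eval_double, square_eval, ih, chebyshevT_succ]
    ring

/-- **`τ(T_{2^k}) ≤ 3k`**: the Chebyshev polynomial of degree `2^k` has constant-free complexity
linear in `k` ("the number of real roots of a univariate polynomial can grow exponentially as a
function of its arithmetic circuit size: Chebyshev polynomials provide such an example").
[cite: Koiran2011, §1 (p. 3)] -/
theorem constantFreeComplexity_chebyshevT_le (k : ℕ) :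
    constantFreeComplexity (chebyshevT k) ≤ 3 * k := by
  rw [← size_chebyshevCircuit k]
  exact constantFreeComplexity_le_size (isFanInTwo_chebyshevCircuit k)
    (hasSignConstants_chebyshevCircuit k) (eval_chebyshevCircuit k)

/-- **`T_{2^k}` has exactly `2^k` distinct real zeros** (`cos((2j+1)π/2^{k+1})`, `j < 2^k`).
[cite: Koiran2011, §1 (p. 3)] -/
theorem card_realRoots_chebyshevT (k : ℕ) :
    ((T ℤ ((2 ^ k : ℕ) : ℤ)).map (Int.castRingHom ℝ)).roots.toFinset.card = 2 ^ k := by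
  rw [map_T, roots_T_real, Finset.val_toFinset,
    Finset.card_image_of_injOn
      ((Finset.range _).nodup_map_iff_injOn.mp (roots_T_real_nodup _)),
    Finset.card_range]

/-- The univariate polynomial `T_{2^k} ∈ ℤ[X]` is nonzero. [folklore] -/
theorem chebyshev_T_two_pow_ne_zero (k : ℕ) : T ℤ ((2 ^ k : ℕ) : ℤ) ≠ 0 := by
  intro h
  have hc := card_realRoots_chebyshevT k
  rw [h, Polynomial.map_zero, roots_zero, Multiset.toFinset_zero, Finset.card_empty] at hc
  exact absurd hc.symm (pow_ne_zero k two_ne_zero)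

/-! ### Technique class and the barrier -/

/-- **Technique class: real-zero counting with exponent `c`.** The real-analysis strengthening of
the τ-conjecture: every nonzero `f ∈ ℤ[X]` has at most `(τ(f) + 2)^c` distinct REAL zeros, with
`τ` rendered as in `CplxAlg.ShubSmaleTauConjecture` ("a bound on the number of real roots of a
polynomial is a fortiori a bound on its number of integer roots").
[cite: Koiran2011, §1 (p. 3)] [cite: Burgisser2024Completeness, §4.6] -/
def RealZeroTauBound (c : ℕ) : Prop :=
  ∀ f : Polynomial ℤ, f ≠ 0 →
    (f.map (Int.castRingHom ℝ)).roots.toFinset.card ≤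
      (constantFreeComplexity ((MvPolynomial.uniqueAlgEquiv ℤ (Fin 1)).symm f) + 2) ^ c

/-- The technique class is monotone in the exponent. [folklore] -/
theorem RealZeroTauBound.mono {c c' : ℕ} (hc : c ≤ c') (h : RealZeroTauBound c) :
    RealZeroTauBound c' := fun f hf =>
  (h f hf).trans (Nat.pow_le_pow_right (by omega) hc)

/-- A real-zero bound is a fortiori an integer-zero bound: `RealZeroTauBound c` implies the
τ-conjecture with exponent `c` (same shape as `CplxAlg.ShubSmaleTauConjecture`).
[cite: Koiran2011, §1 (p. 3)] -/
theorem RealZeroTauBound.integerZeros {c : ℕ} (h : RealZeroTauBound c) (f : Polynomial ℤ)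
    (hf : f ≠ 0) :
    f.roots.toFinset.card ≤
      (constantFreeComplexity ((MvPolynomial.uniqueAlgEquiv ℤ (Fin 1)).symm f) + 2) ^ c := by
  refine le_trans ?_ (h f hf)
  have hinj : Function.Injective (Int.castRingHom ℝ) := Int.cast_injective
  have hle : f.roots.map (Int.castRingHom ℝ) ≤ (f.map (Int.castRingHom ℝ)).roots :=
    map_roots_le_of_injective f hinj
  calc f.roots.toFinset.card
      = (f.roots.toFinset.image (Int.castRingHom ℝ)).card :=
        (Finset.card_image_of_injective _ hinj).symm
    _ = (f.roots.map (Int.castRingHom ℝ)).toFinset.card := by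
        rw [Multiset.toFinset_map]
    _ ≤ (f.map (Int.castRingHom ℝ)).roots.toFinset.card := by
        apply Finset.card_le_card
        intro x hx
        rw [Multiset.mem_toFinset] at hx ⊢
        exact Multiset.mem_of_le hle hx

/-- Real-zero counting implies the Shub–Smale τ-conjecture (tree statement). [cite: Koiran2011, §1 (p. 3)] -/
theorem RealZeroTauBound.shubSmaleTauConjecture {c : ℕ} (h : RealZeroTauBound c) :
    ShubSmaleTauConjecture :=
  ⟨c, fun f hf => h.integerZeros f hf⟩

/-- **Barrier: the τ-conjecture is false for real zeros (Chebyshev polynomials).**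

BARRIER
technique_class: real-root-counting, real-analysis, Descartes-type zero bounds, fewnomial / additive-complexity bounds applied to general straight-line programs (`RealZeroTauBound c`: distinct real zeros of every nonzero `f ∈ ℤ[X]` bounded by `(τ(f)+2)^c`; audit 2026-08-17: equally excluded are every subexponential rate — a monotone bound `z_ℝ(f) ≤ F(τ(f))` forces `2^k ≤ F(3k)`, `two_pow_le_of_realZeroBound`, `not_realZeroBound_quasipoly` — and counts of real zeros pairwise `≥ 1` apart, `SeparatedRealZeroTauBound c`, `not_separatedRealZeroTauBound`)
blocks: the real-analysis way to the Shub–Smale τ-conjecture `CplxAlg.ShubSmaleTauConjecture` (every `RealZeroTauBound c` would imply it, `RealZeroTauBound.shubSmaleTauConjecture`) and thereby to the constant-free form of `ValiantsHypothesis` on route `ValiantsHypothesis/TauConst` (`τ(PER_n)` not polynomially bounded, `CplxAlg.not_isPBounded_constantFreeComplexity_perPoly_of_tauConjecture` [cite: Burgisser2009, Main Thm. 1.2]; "The τ-conjecture implies `VP⁰ ≠ VNP⁰`" [cite: Burgisser2024Completeness, §4.6 (Thm. 4.17)]): `TauRealZeros` = `∀ c, ¬ RealZeroTauBound c`, proved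 (`tauRealZeros_holds`) — "It is known that this approach cannot work for the original τ-conjecture because the number of real roots of a univariate polynomial can grow exponentially as a function of its arithmetic circuit size: Chebyshev polynomials provide such an example" [cite: Koiran2011, §1 (p. 3)]; "The τ-conjecture is false when replacing "integer zeros" by "real zeros"" [cite: Burgisser2024Completeness, §4.6].
because: `T_{2^k} = T_2 ∘ ⋯ ∘ T_2` with `T_2 = 2X² - 1` is computed from `X` with `3k` constant-free gates (`constantFreeComplexity_chebyshevT_le`), while `T_{2^k}` has `2^k` distinct real zeros `cos((2j+1)π/2^{k+1})` (`card_realRoots_chebyshevT`), and `2^k > (3k+2)^c` for large `k` [cite: Koiran2011, §1 (p. 3)].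
evasions_known: restrict the class of polynomials rather than the zeros — for sums of `k` products of `m` `t`-sparse polynomials Koiran's real τ-conjecture (tree `CplxAlg.KoiranRealTauConjecture`; "We conjecture that this behavior is not possible for sums of products of sparse polynomials") still yields `per ∉ VP⁰`, indeed `τ(PER_n) = n^{ω(1)}` (`CplxAlg.not_isPBounded_constantFreeComplexity_perPoly_of_realTauConjecture`) [cite: Koiran2011, §1 (p. 3) and §6 (Conj. 3, Thm. 7)] [cite: Tavenas2014, Thm. 3.3]; it holds for `k = 1` by Descartes' rule and is true on average [cite: Koiran2011, §6] [cite: BriquelBurgisser2020, Thm. 1]; further restricted variants: the SoS-τ-conjecture and Hrubeš's complex-zero reformulations [cite: Burgisser2024Completeness, §4.6 (Conj. 4.1–4.2)]. Or change the PLACE rather than the class (audit 2026-08-17): count zeros in a local field allowed to depend on `f` — the Adelic τ-Conjecture "there is an absolute constant `c` such that, for any `f ∈ ℤ[x₁]`, there is a field `L ∈ {ℝ, ℚ₂, ℚ₃, ℚ₅, …}` such that `f` has no more than `(τ(f)+1)^c` roots in `L`", which "clearly implies the Standard τ-Conjecture and, so far, has no counter-examples", whereas every FIXED place fails like `ℝ`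 does (Poonen's `p`-adic analogues; for each `k` a family with `2^n - 2` roots in `ℤ_p` for all `p ≤ p_k`, `τ = O(n + k log² k)`, and no real root) [cite: PhillipsonRojas2013, §1.2 (Ex. 1.10, Lemma 1.11, Adelic τ-Conjecture 1)]; the additive-complexity / fewnomial route gives for general computations only `¼√(log N) ≤ L⁺(f)` (Grigoriev–Risler), at best `c log N ≤ L⁺(f)` (open Problem 12.3), i.e. real-zero bounds exponential in the gate count, for which "the Chebyshev polynomials … show that this is the best result of its kind which can be expected" [cite: BurgisserClausenShokrollahi1997, Ch. 12 (Thm. 12.12, Ex. 12.13, Problem 12.3)].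
scope_caveats: only REAL-zero COUNTS for GENERAL constant-free straight-line programs are excluded (at every subexponential rate and even for `1`-separated zero sets, see technique_class) — nothing is said about integer or rational zeros (the τ-conjecture itself is open), about `p`-adic / adelic counts with an `f`-dependent place (evasions_known), about real zeros of restricted families (sums of products of sparse polynomials, where "the few known examples of polynomials with short arithmetic circuits but many real roots ... are definitely not given as sums of products of sparse polynomials" [cite: Koiran2011, §6]), nor about criteria using the exact ARITHMETIC structure of the zero set (e.g. `n` real zeros in arithmetic progression, the shape of the Pochhammer–Wilkinson polynomials `∏_{i≤n}(X - i)` whose hardness together with their integer multiples is what the transfer needs: "it suffices to prove that for all nonzero integers `m_n`, the sequence `(m_n n!)` … is hard to compute" [cite: Burgisser2024Completeness, §4.6 (p. 19)]) — the Chebyshev / dilated-Dickson / logistic witnesses have arcsine-distributed, not equally spaced, zeros; the sources state the counterexample qualitatively ("can grow exponentially"), the constants `3k`, `k(2k+7)` and base `τ + 2` are this file's, for the tree's rendering `CplxAlg.constantFreeComplexity` of `τ` (Shub–Smale's `τ` up to a factor `≤ 3`, see `TauConjecture.lean`); Borodin–Cook's earlier example mentioned by Koiran and the logistic family of [cite: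 PhillipsonRojas2013, Ex. 1.10] are not formalised (the latter is affinely conjugate to `T_{2^n}`).
status: theorem (established; proved here as `tauRealZeros_holds`; barrier audit 2026-08-17: CONFIRMED on the page and strengthened in the tree — `not_realZeroBound_of_lt_two_pow`, `not_realZeroBound_quasipoly`, `not_separatedRealZeroTauBound`) [cite: Koiran2011, §1 (p. 3)] [cite: Burgisser2024Completeness, §4.6] -/
def TauRealZeros : Prop :=
  ∀ c : ℕ, ¬ RealZeroTauBound c

/-- **The barrier holds**: for every exponent `c`, `T_{2^k}` with `k` large violates
`RealZeroTauBound c`. [cite: Koiran2011, §1 (p. 3)] -/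
theorem tauRealZeros_holds : TauRealZeros := by
  intro c hc
  obtain ⟨T₀, hT⟩ := eventually_mul_pow_lt_two_pow c (5 ^ c)
  set t : ℕ := max T₀ 1 with ht
  have ht1 : 1 ≤ t := le_max_right _ _
  have hlt : 5 ^ c * t ^ c < 2 ^ t := hT t (le_max_left _ _)
  have h := hc (T ℤ ((2 ^ t : ℕ) : ℤ)) (chebyshev_T_two_pow_ne_zero t)
  rw [card_realRoots_chebyshevT] at h
  have hτ : constantFreeComplexity ((MvPolynomial.uniqueAlgEquiv ℤ (Fin 1)).symm
      (T ℤ ((2 ^ t : ℕ) : ℤ))) ≤ 3 * t := constantFreeComplexity_chebyshevT_le t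
  have h2 : (constantFreeComplexity ((MvPolynomial.uniqueAlgEquiv ℤ (Fin 1)).symm
      (T ℤ ((2 ^ t : ℕ) : ℤ))) + 2) ^ c ≤ (5 * t) ^ c :=
    Nat.pow_le_pow_left (by omega) c
  rw [mul_pow] at h2
  omega

/-- The real-zeros analogue of `CplxAlg.ShubSmaleTauConjecture`, in the same shape, is false. [cite: Burgisser2024Completeness, §4.6] -/
theorem not_exists_realZeroTauBound : ¬ ∃ c : ℕ, RealZeroTauBound c :=
  fun ⟨c, hc⟩ => tauRealZeros_holds c hc

/-- Quantitative form: for every `c` there is an explicit nonzero `f = T_{2^k}` with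
`(τ(f) + 2)^c < #{distinct real zeros of f}`. [cite: Koiran2011, §1 (p. 3)] -/
theorem exists_realRoots_gt_pow (c : ℕ) :
    ∃ f : Polynomial ℤ, f ≠ 0 ∧
      (constantFreeComplexity ((MvPolynomial.uniqueAlgEquiv ℤ (Fin 1)).symm f) + 2) ^ c <
        (f.map (Int.castRingHom ℝ)).roots.toFinset.card := by
  by_contra h
  push Not at h
  exact tauRealZeros_holds c (fun f hf => h f hf)

/-! ### Growth-rate-agnostic form of the obstruction (audit 2026-08-17)

The printed obstruction is "the number of real roots … can grow exponentially as a function of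
its arithmetic circuit size" [Koiran2011, §1 (p. 3)], i.e. it kills EVERY subexponential real-zero
bound, not only the polynomial shape `(τ + 2)^c` of `RealZeroTauBound`; and weaker-than-polynomial
shapes matter, because Koiran notes that a bound `q(s) ≤ 2^{(log s)^{1+c}}` (`c < 1`) on the real
zeros of SPS polynomials "would still be strong enough to conclude that the permanent is not in
VP⁰", and even `q(s) = 2^{s^{o(1)}}` gives depth-4 lower bounds [Koiran2011, §6 (p. 11, before and in
Prop. 2)]. The three theorems below make the barrier formally cover all such rates for GENERAL
constant-free circuits: a monotone `F` with `z_ℝ(f) ≤ F(τ(f))` for all `f ≠ 0` must satisfy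
`2^k ≤ F(3k)` for every `k`. -/

/-- **Exponential form of the witness**: for every `k` an explicit nonzero `f = T_{2^k}` with
`τ(f) ≤ 3k` and exactly `2^k` distinct real zeros. [cite: Koiran2011, §1 (p. 3)] -/
theorem exists_tau_le_realRoots_eq_two_pow (k : ℕ) :
    ∃ f : Polynomial ℤ, f ≠ 0 ∧
      constantFreeComplexity ((MvPolynomial.uniqueAlgEquiv ℤ (Fin 1)).symm f) ≤ 3 * k ∧
        (f.map (Int.castRingHom ℝ)).roots.toFinset.card = 2 ^ k :=
  ⟨T ℤ ((2 ^ k : ℕ) : ℤ), chebyshev_T_two_pow_ne_zero k, constantFreeComplexity_chebyshevT_le k,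
    card_realRoots_chebyshevT k⟩

/-- **Any real-zero bound in terms of `τ` is at least exponential**: if a monotone `F : ℕ → ℕ`
bounds the number of distinct real zeros of every nonzero `f ∈ ℤ[X]` by `F(τ(f))`, then
`2^k ≤ F(3k)` for all `k` ("can grow exponentially as a function of its arithmetic circuit
size"). Monotonicity is no restriction: the running maximum of any valid bound is a valid monotone
bound. [cite: Koiran2011, §1 (p. 3)] -/
theorem two_pow_le_of_realZeroBound {F : ℕ → ℕ} (hF : Monotone F)
    (h : ∀ f : Polynomial ℤ, f ≠ 0 →
      (f.map (Int.castRingHom ℝ)).roots.toFinset.card ≤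
        F (constantFreeComplexity ((MvPolynomial.uniqueAlgEquiv ℤ (Fin 1)).symm f)))
    (k : ℕ) : 2 ^ k ≤ F (3 * k) := by
  obtain ⟨f, hf, hτ, hz⟩ := exists_tau_le_realRoots_eq_two_pow k
  exact hz ▸ (h f hf).trans (hF hτ)

/-- **Barrier, growth-rate-agnostic form**: a monotone `F` with `F(3k) < 2^k` for a single `k`
is not a bound on the distinct real zeros of nonzero integer polynomials in terms of `τ`; this
covers the polynomial shapes of `TauRealZeros` as well as every quasi-polynomial or
`2^{s^{o(1)}}` shape. [cite: Koiran2011, §1 (p. 3) and §6 (p. 11)] -/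
theorem not_realZeroBound_of_lt_two_pow {F : ℕ → ℕ} (hF : Monotone F) {k : ℕ}
    (hk : F (3 * k) < 2 ^ k) :
    ¬ ∀ f : Polynomial ℤ, f ≠ 0 →
      (f.map (Int.castRingHom ℝ)).roots.toFinset.card ≤
        F (constantFreeComplexity ((MvPolynomial.uniqueAlgEquiv ℤ (Fin 1)).symm f)) :=
  fun h => (two_pow_le_of_realZeroBound hF h k).not_gt hk

/-- **The quasi-polynomial shape is excluded too**: for no `c` is `2^{(log₂ (τ(f)+2))^c}` a bound
on the distinct real zeros of every nonzero `f ∈ ℤ[X]` — the general-circuit analogue of Koiran's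
weakened bound `q(s) ≤ 2^{(log s)^{1+c}}`, which for SPS polynomials would still yield
`per ∉ VP⁰`. Witness `T_{2^k}` with `k = 2^m`, `3^c m^c < 2^m`. [cite: Koiran2011, §6 (p. 11)] -/
theorem not_realZeroBound_quasipoly (c : ℕ) :
    ¬ ∀ f : Polynomial ℤ, f ≠ 0 →
      (f.map (Int.castRingHom ℝ)).roots.toFinset.card ≤
        2 ^ Nat.log 2 (constantFreeComplexity ((MvPolynomial.uniqueAlgEquiv ℤ (Fin 1)).symm f) + 2) ^ c := by
  have hmono : Monotone fun t : ℕ => 2 ^ Nat.log 2 (t + 2) ^ c := fun s t hst =>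
    Nat.pow_le_pow_right two_pos (Nat.pow_le_pow_left (Nat.log_mono_right (by omega)) c)
  obtain ⟨T, hT⟩ := eventually_mul_pow_lt_two_pow c (3 ^ c)
  set m : ℕ := max T 1 with hm
  have hm1 : 1 ≤ m := le_max_right _ _
  have hlt : 3 ^ c * m ^ c < 2 ^ m := hT m (le_max_left _ _)
  refine not_realZeroBound_of_lt_two_pow (F := fun t : ℕ => 2 ^ Nat.log 2 (t + 2) ^ c) hmono
    (k := 2 ^ m) ?_
  apply Nat.pow_lt_pow_right (by norm_num)
  have hlog : Nat.log 2 (3 * 2 ^ m + 2) < m + 3 := by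
    apply Nat.log_lt_of_lt_pow (by omega)
    rw [pow_add]
    have : (0:ℕ) < 2 ^ m := Nat.two_pow_pos m
    norm_num
    omega
  calc Nat.log 2 (3 * 2 ^ m + 2) ^ c ≤ (m + 2) ^ c := Nat.pow_le_pow_left (by omega) c
    _ ≤ (3 * m) ^ c := Nat.pow_le_pow_left (by omega) c
    _ = 3 ^ c * m ^ c := by rw [mul_pow]
    _ < 2 ^ m := hlt

/-! ### Integer dilation: the obstruction survives metric separation (audit 2026-08-17)

Integer zeros are pairwise at distance `≥ 1`, while the `2^k` zeros of `T_{2^k}` crowd into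
`(-1, 1)`; so one might hope that counting only WELL-SEPARATED real zeros ("at most one zero per
unit cell", Descartes-type counts over an integer grid) evades the Chebyshev example. It does not:
dilating by the cheap integer `a = 2^{2^k}` (repeated squaring) spreads the zeros while keeping `τ`
polynomial in `k`. Concretely the monic recurrence `E_{k,0} = X`, `E_{k,j+1} = E_{k,j}^2 - 2a^{2^{j+1}}`
computes `E_{k,j} = a^{2^j} D_{2^j}(X/a)` for the Dickson polynomial `D_n(x) = 2 T_n(x/2)`
(`E_{k,j}(2a cos θ) = 2a^{2^j} cos(2^j θ)`, `eval_dilDickson`), so `E_{k,k}` has `τ ≤ k(2k + 7)`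
(`constantFreeComplexity_dilDickson_le`) and the `2^k` real zeros `2a cos((2i+1)π/2^{k+1})`, which
are pairwise `≥ 8a/4^k ≥ 1` apart (`one_le_abs_dilNode_sub`, from
`cos θ_i - cos θ_{i'} ≥ 4/4^k`, Jordan's inequality). Hence `¬ SeparatedRealZeroTauBound c` for
every `c` (`not_separatedRealZeroTauBound`): integrality has to enter ARITHMETICALLY (heights,
reduction mod `p`, `p`-adic places as in the adelic τ-conjecture [PhillipsonRojas2013, §1.2]), not
metrically. The dilation trick is folklore; the sources state only the undilated example
[Koiran2011, §1 (p. 3)] [PhillipsonRojas2013, Ex. 1.10 (the conjugate logistic family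
`h_{n+1} = 4h_n(1-h_n)`: `2^n` roots in `(0,1)`, `τ = O(n)`)]. -/

/-- The dilated Dickson polynomials `E_{k,0} = X`, `E_{k,j+1} = E_{k,j}^2 - 2·2^{2^{k+j+1}}`
(`= E_{k,j}^2 - 2a^{2^{j+1}}` with `a = 2^{2^k}`), in `ℤ[X]`. [folklore] -/
def dilDickson (k : ℕ) : ℕ → Polynomial ℤ
  | 0 => Polynomial.X
  | j + 1 => dilDickson k j ^ 2 - Polynomial.C (2 * 2 ^ 2 ^ (k + j + 1))

/-- Trigonometric evaluation: `E_{k,j}(2a cos θ) = 2 a^{2^j} cos(2^j θ)`, `a = 2^{2^k}` (double-angle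
formula; this is `D_n(2cos θ) = 2cos(nθ)` dilated). [folklore] -/
theorem eval_dilDickson (k j : ℕ) (θ : ℝ) :
    ((dilDickson k j).map (Int.castRingHom ℝ)).eval (2 * 2 ^ 2 ^ k * Real.cos θ) =
      2 * ((2 : ℝ) ^ 2 ^ k) ^ 2 ^ j * Real.cos (2 ^ j * θ) := by
  induction j with
  | zero => simp [dilDickson]
  | succ j ih =>
    simp only [dilDickson, Polynomial.map_sub, Polynomial.map_pow, Polynomial.map_C,
      Polynomial.eval_sub, Polynomial.eval_pow, Polynomial.eval_C, ih]
    have hcos : Real.cos (2 ^ (j + 1) * θ) = 2 * Real.cos (2 ^ j * θ) ^ 2 - 1 := by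
      rw [pow_succ, mul_comm ((2 : ℝ) ^ j) 2, mul_assoc, Real.cos_two_mul]
    have hA : (((2 : ℝ) ^ 2 ^ k) ^ 2 ^ j) ^ 2 = ((2 : ℝ) ^ 2 ^ k) ^ 2 ^ (j + 1) := by
      rw [← pow_mul, pow_succ]
    have hB : ((2 : ℝ) ^ 2 ^ k) ^ 2 ^ (j + 1) = (2 : ℝ) ^ 2 ^ (k + j + 1) := by
      rw [← pow_mul, ← pow_add]; ring_nf
    rw [hcos]
    simp only [map_mul, map_pow, eq_intCast, Int.cast_ofNat]
    rw [← hB, ← hA]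
    ring

/-- **`τ(E_{k,j}) ≤ j(k + j + 7)`**: each step costs one squaring, one subtraction (`≤ 2` gates) and
the constant `2·2^{2^{k+j+1}}` (`≤ k + j + 4` gates by repeated squaring,
`constantFreeComplexity_C_two_pow_two_pow_le`). [folklore] -/
theorem constantFreeComplexity_dilDickson_le (k j : ℕ) :
    constantFreeComplexity ((MvPolynomial.uniqueAlgEquiv ℤ (Fin 1)).symm (dilDickson k j)) ≤
      j * (k + j + 7) := by
  have hC : ∀ z : ℤ, (MvPolynomial.uniqueAlgEquiv ℤ (Fin 1)).symm (Polynomial.C z) =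
      (MvPolynomial.C z : MvPolynomial (Fin 1) ℤ) := fun z => by simp
  induction j with
  | zero => simp [dilDickson]
  | succ j ih =>
    simp only [dilDickson, map_sub, map_pow, hC]
    have hconst : constantFreeComplexity
        (MvPolynomial.C (2 * 2 ^ 2 ^ (k + j + 1)) : MvPolynomial (Fin 1) ℤ) ≤ k + j + 4 := by
      rw [show (MvPolynomial.C (2 * 2 ^ 2 ^ (k + j + 1)) : MvPolynomial (Fin 1) ℤ) =
          MvPolynomial.C 2 * MvPolynomial.C ((2 : ℤ) ^ 2 ^ (k + j + 1)) by
            rw [← MvPolynomial.C_mul]]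
      calc constantFreeComplexity (MvPolynomial.C 2 * MvPolynomial.C ((2 : ℤ) ^ 2 ^ (k + j + 1)) :
              MvPolynomial (Fin 1) ℤ)
          ≤ constantFreeComplexity (MvPolynomial.C 2 : MvPolynomial (Fin 1) ℤ) +
              constantFreeComplexity (MvPolynomial.C ((2 : ℤ) ^ 2 ^ (k + j + 1)) :
                MvPolynomial (Fin 1) ℤ) + 1 := constantFreeComplexity_mul_le _ _
        _ ≤ 1 + (k + j + 1 + 1) + 1 := by
            gcongr
            · exact constantFreeComplexity_C_two_le
            · exact constantFreeComplexity_C_two_pow_two_pow_le _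
        _ = k + j + 4 := by ring
    calc constantFreeComplexity
          (((MvPolynomial.uniqueAlgEquiv ℤ (Fin 1)).symm (dilDickson k j)) ^ 2 -
            MvPolynomial.C (2 * 2 ^ 2 ^ (k + j + 1)))
        ≤ constantFreeComplexity (((MvPolynomial.uniqueAlgEquiv ℤ (Fin 1)).symm (dilDickson k j)) ^ 2) +
            constantFreeComplexity
              (MvPolynomial.C (2 * 2 ^ 2 ^ (k + j + 1)) : MvPolynomial (Fin 1) ℤ) + 2 :=
          constantFreeComplexity_sub_le _ _
      _ ≤ (constantFreeComplexity ((MvPolynomial.uniqueAlgEquiv ℤ (Fin 1)).symm (dilDickson k j)) + 1) +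
            (k + j + 4) + 2 := by
          gcongr
          exact constantFreeComplexity_sq_le _
      _ ≤ (j * (k + j + 7) + 1) + (k + j + 4) + 2 := by gcongr
      _ ≤ (j + 1) * (k + (j + 1) + 7) := by nlinarith

/-- The `i`-th Chebyshev angle at level `k`: `θ_{k,i} = (2i+1)π/2^{k+1}`. [folklore] -/
def chebAngle (k i : ℕ) : ℝ := (2 * i + 1) * Real.pi / 2 ^ (k + 1)

/-- The dilated Chebyshev nodes `x_{k,i} = 2 · 2^{2^k} · cos θ_{k,i}` (`= 2a cos θ_{k,i}`). [folklore] -/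
def dilNode (k i : ℕ) : ℝ := 2 * 2 ^ 2 ^ k * Real.cos (chebAngle k i)

/-- `0 ≤ θ_{k,i}`. [folklore] -/
theorem chebAngle_nonneg (k i : ℕ) : 0 ≤ chebAngle k i := by
  unfold chebAngle; positivity

/-- `θ_{k,i} ≤ π` for `i < 2^k`. [folklore] -/
theorem chebAngle_le_pi {k i : ℕ} (hi : i < 2 ^ k) : chebAngle k i ≤ Real.pi := by
  unfold chebAngle
  rw [div_le_iff₀ (by positivity)]
  have h : (2 * (i : ℝ) + 1) ≤ 2 ^ (k + 1) := by
    have : (i : ℝ) + 1 ≤ 2 ^ k := by exact_mod_cast hi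
    rw [pow_succ]; nlinarith
  nlinarith [Real.pi_pos]

/-- `cos (2^k θ_{k,i}) = cos((2i+1)π/2) = 0`. [folklore] -/
theorem cos_two_pow_mul_chebAngle (k i : ℕ) : Real.cos (2 ^ k * chebAngle k i) = 0 := by
  rw [Real.cos_eq_zero_iff]
  refine ⟨i, ?_⟩
  unfold chebAngle
  rw [pow_succ]
  field_simp
  push_cast
  ring

/-- Every dilated node `2a cos θ_{k,i}` is a real root of `E_{k,k}`. [folklore] -/
theorem isRoot_dilDickson_dilNode (k i : ℕ) :
    ((dilDickson k k).map (Int.castRingHom ℝ)).IsRoot (dilNode k i) := by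
  rw [IsRoot.def, dilNode, eval_dilDickson, cos_two_pow_mul_chebAngle, mul_zero]

/-- `E_{k,k}` does not vanish at `2a` (`θ = 0`), so it is a nonzero polynomial. [folklore] -/
theorem dilDickson_ne_zero (k : ℕ) : dilDickson k k ≠ 0 := by
  intro h
  have := eval_dilDickson k k 0
  rw [h, Real.cos_zero, mul_one, mul_zero, Real.cos_zero, mul_one, Polynomial.map_zero,
    Polynomial.eval_zero] at this
  have h2 : (0 : ℝ) < 2 * ((2 : ℝ) ^ 2 ^ k) ^ 2 ^ k := by positivity
  linarith

/-- The nodes are injective in `i < 2^k` (`cos` is injective on `[0, π]`). [folklore] -/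
theorem dilNode_injOn (k : ℕ) : Set.InjOn (dilNode k) (Set.Iio (2 ^ k)) := by
  intro i hi i' hi' h
  simp only [Set.mem_Iio] at hi hi'
  unfold dilNode at h
  have h2 : (0 : ℝ) < 2 * (2 : ℝ) ^ 2 ^ k := by positivity
  have hcos : Real.cos (chebAngle k i) = Real.cos (chebAngle k i') :=
    mul_left_cancel₀ h2.ne' h
  have hθ : chebAngle k i = chebAngle k i' :=
    Real.injOn_cos ⟨chebAngle_nonneg k i, chebAngle_le_pi hi⟩
      ⟨chebAngle_nonneg k i', chebAngle_le_pi hi'⟩ hcos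
  unfold chebAngle at hθ
  rw [div_left_inj' (by positivity)] at hθ
  have := mul_right_cancel₀ Real.pi_pos.ne' hθ
  exact_mod_cast (by linarith : (i : ℝ) = i')

/-- Jordan's inequality on `[0, π]`: if `m ≤ x ≤ π - m` (`0 ≤ m`) then `sin x ≥ (2/π) m`. [folklore] -/
theorem sin_ge_of_mem {x m : ℝ} (hm : m ≤ x) (hx : x ≤ Real.pi - m) (hm0 : 0 ≤ m) :
    2 / Real.pi * m ≤ Real.sin x := by
  rcases le_or_gt x (Real.pi / 2) with hle | hgt
  · exact (mul_le_mul_of_nonneg_left hm (by positivity)).trans (Real.mul_le_sin (hm0.trans hm) hle)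
  · rw [← Real.sin_pi_sub]
    exact (mul_le_mul_of_nonneg_left (by linarith) (by positivity)).trans
      (Real.mul_le_sin (by linarith) (by linarith))

/-- Separation of the cosines of distinct Chebyshev angles: `cos θ_{k,i} - cos θ_{k,i'} ≥ 4/4^k`
for `i < i' < 2^k` (`cos θ - cos θ' = 2 sin((θ'+θ)/2) sin((θ'-θ)/2)`, both sines `≥ 2/2^k`,
`1/2^k` by Jordan's inequality). [folklore] -/
theorem cos_chebAngle_sub_ge {k i i' : ℕ} (hii' : i < i') (hi' : i' < 2 ^ k) :
    4 / 4 ^ k ≤ Real.cos (chebAngle k i) - Real.cos (chebAngle k i') := by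
  have hn : (0 : ℝ) < 2 ^ k := by positivity
  set n : ℝ := 2 ^ k with hn_def
  have hi'r : (i' : ℝ) + 1 ≤ n := by rw [hn_def]; exact_mod_cast hi'
  have hii'r : (i : ℝ) + 1 ≤ i' := by exact_mod_cast hii'
  rw [Real.cos_sub_cos]
  -- the two half-angles
  have hsum : (chebAngle k i + chebAngle k i') / 2 = (i + i' + 1) * Real.pi / (2 * n) := by
    unfold chebAngle; rw [hn_def, pow_succ]; field_simp; ring
  have hdiff : (chebAngle k i - chebAngle k i') / 2 = -((i' - i) * Real.pi / (2 * n)) := by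
    unfold chebAngle; rw [hn_def, pow_succ]; field_simp; ring
  rw [hsum, hdiff, Real.sin_neg]
  have hpn : 0 < Real.pi * n := mul_pos Real.pi_pos hn
  have hi0 : (0 : ℝ) ≤ i := Nat.cast_nonneg i
  -- sin of the difference half-angle ≥ 1/n
  have h1 : 2 / Real.pi * (Real.pi / (2 * n)) ≤ Real.sin ((i' - i) * Real.pi / (2 * n)) := by
    apply sin_ge_of_mem
    · rw [div_le_div_iff_of_pos_right (by positivity)]
      nlinarith [Real.pi_pos]
    · rw [le_sub_iff_add_le, ← add_div, div_le_iff₀ (by positivity)]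
      have h3 : ((i' : ℝ) - i) + 2 ≤ 2 * n := by linarith
      nlinarith [mul_le_mul_of_nonneg_left h3 hpn.le]
    · positivity
  -- sin of the sum half-angle ≥ 2/n
  have h2 : 2 / Real.pi * (Real.pi / n) ≤ Real.sin ((i + i' + 1) * Real.pi / (2 * n)) := by
    apply sin_ge_of_mem
    · rw [div_le_div_iff₀ (by positivity) (by positivity)]
      have h3 : (2 : ℝ) ≤ i + i' + 1 := by linarith
      nlinarith [mul_le_mul_of_nonneg_left h3 hpn.le]
    · rw [le_sub_iff_add_le, div_add_div _ _ (by positivity) (by positivity),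
        div_le_iff₀ (by positivity)]
      have h3 : (i : ℝ) + i' + 3 ≤ 2 * n := by linarith
      have hpnn : 0 ≤ Real.pi * n * n := by positivity
      nlinarith [mul_le_mul_of_nonneg_left h3 hpnn]
    · positivity
  have e1 : 2 / Real.pi * (Real.pi / (2 * n)) = 1 / n := by field_simp
  have e2 : 2 / Real.pi * (Real.pi / n) = 2 / n := by field_simp
  rw [e1] at h1
  rw [e2] at h2
  have e3 : (4 : ℝ) / 4 ^ k = 2 * (2 / n) * (1 / n) := by
    have h4 : (4 : ℝ) ^ k = n * n := by rw [hn_def, ← mul_pow]; norm_num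
    rw [h4]; field_simp; ring
  rw [e3]
  have h1' : (0 : ℝ) ≤ 1 / n := by positivity
  have h2' : (0 : ℝ) ≤ 2 / n := by positivity
  nlinarith [mul_le_mul h2 h1 h1' ((h2'.trans h2))]

/-- The elementary inequality `4^k ≤ 8 · 2^{2^k}`. [folklore] -/
theorem four_pow_le (k : ℕ) : (4 : ℝ) ^ k ≤ 8 * 2 ^ 2 ^ k := by
  have h : 2 * k ≤ 2 ^ k + 3 := by
    cases k with
    | zero => norm_num
    | succ j => have := j.lt_two_pow_self; rw [pow_succ]; omega
  calc (4 : ℝ) ^ k = 2 ^ (2 * k) := by rw [pow_mul]; norm_num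
    _ ≤ 2 ^ (2 ^ k + 3) := pow_le_pow_right₀ (by norm_num) h
    _ = 8 * 2 ^ 2 ^ k := by rw [pow_add]; ring

/-- The dilated nodes are pairwise at distance `≥ 1` (indeed `≥ 8a/4^k`). [folklore] -/
theorem one_le_abs_dilNode_sub {k i i' : ℕ} (hi : i < 2 ^ k) (hi' : i' < 2 ^ k) (h : i ≠ i') :
    1 ≤ |dilNode k i - dilNode k i'| := by
  wlog hlt : i < i' generalizing i i'
  · rw [abs_sub_comm]; exact this hi' hi h.symm (lt_of_le_of_ne (not_lt.mp hlt) h.symm)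
  have hsep := cos_chebAngle_sub_ge hlt hi'
  have hA : (0 : ℝ) < 2 * 2 ^ 2 ^ k := by positivity
  have hpos : 0 ≤ Real.cos (chebAngle k i) - Real.cos (chebAngle k i') :=
    le_trans (by positivity) hsep
  rw [dilNode, dilNode, ← mul_sub, abs_of_nonneg (mul_nonneg hA.le hpos)]
  have h4 := four_pow_le k
  have h4k : (0 : ℝ) < 4 ^ k := by positivity
  calc (1 : ℝ) = (4 ^ k / 4) * (4 / 4 ^ k) := by field_simp
    _ ≤ (2 * 2 ^ 2 ^ k) * (4 / 4 ^ k) := by gcongr; linarith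
    _ ≤ (2 * 2 ^ 2 ^ k) * (Real.cos (chebAngle k i) - Real.cos (chebAngle k i')) := by gcongr


/-! ### The wider technique class: counting well-separated real zeros -/

/-- **Technique class: counting `1`-separated real zeros with exponent `c`.** Every finite set of
real zeros of a nonzero `f ∈ ℤ[X]` whose elements are pairwise at distance `≥ 1` ("at most one
zero per unit cell", as integer zeros are) has at most `(τ(f) + 2)^c` elements, `τ` rendered as in
`RealZeroTauBound`. Wider than `RealZeroTauBound c` (`RealZeroTauBound.separated`) and still a
fortiori an integer-zero bound (`SeparatedRealZeroTauBound.integerZeros`); refuted below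
(`not_separatedRealZeroTauBound`). Introduced by the 2026-08-17 barrier audit. [folklore] -/
def SeparatedRealZeroTauBound (c : ℕ) : Prop :=
  ∀ f : Polynomial ℤ, f ≠ 0 → ∀ S : Finset ℝ,
    (∀ x ∈ S, (f.map (Int.castRingHom ℝ)).IsRoot x) →
    (S : Set ℝ).Pairwise (fun x y => 1 ≤ |x - y|) →
      S.card ≤ (constantFreeComplexity ((MvPolynomial.uniqueAlgEquiv ℤ (Fin 1)).symm f) + 2) ^ c

/-- The separated class is WIDER: a bound on all real zeros is in particular a bound on the
separated ones. [folklore] -/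
theorem RealZeroTauBound.separated {c : ℕ} (h : RealZeroTauBound c) :
    SeparatedRealZeroTauBound c := by
  intro f hf S hS _
  refine le_trans (Finset.card_le_card fun x hx => ?_) (h f hf)
  rw [Multiset.mem_toFinset, mem_roots ((Polynomial.map_ne_zero_iff Int.cast_injective).mpr hf)]
  exact hS x hx

/-- A separated-real-zero bound is still a fortiori an integer-zero bound (distinct integers are
at distance `≥ 1`): `SeparatedRealZeroTauBound c` implies the τ-conjecture with exponent `c`.
[cite: Koiran2011, §1 (p. 3)] -/
theorem SeparatedRealZeroTauBound.integerZeros {c : ℕ} (h : SeparatedRealZeroTauBound c)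
    (f : Polynomial ℤ) (hf : f ≠ 0) :
    f.roots.toFinset.card ≤
      (constantFreeComplexity ((MvPolynomial.uniqueAlgEquiv ℤ (Fin 1)).symm f) + 2) ^ c := by
  have hinj : Function.Injective (Int.castRingHom ℝ) := Int.cast_injective
  rw [← Finset.card_image_of_injective _ hinj]
  refine h f hf _ (fun x hx => ?_) (fun x hx y hy hxy => ?_)
  · obtain ⟨z, hz, rfl⟩ := Finset.mem_image.mp hx
    rw [Multiset.mem_toFinset, mem_roots hf] at hz
    exact IsRoot.map hz
  · obtain ⟨a, -, rfl⟩ := Finset.mem_image.mp hx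
    obtain ⟨b, -, rfl⟩ := Finset.mem_image.mp hy
    have hab : a ≠ b := fun h => hxy (by rw [h])
    simp only [eq_intCast, ← Int.cast_sub, ← Int.cast_abs]
    exact_mod_cast Int.one_le_abs (sub_ne_zero.mpr hab)

/-- The separated class also yields the Shub–Smale τ-conjecture (tree statement). [folklore] -/
theorem SeparatedRealZeroTauBound.shubSmaleTauConjecture {c : ℕ}
    (h : SeparatedRealZeroTauBound c) : ShubSmaleTauConjecture :=
  ⟨c, fun f hf => h.integerZeros f hf⟩

/-- The witness set of the `2^k` dilated nodes has `2^k` elements. [folklore] -/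
theorem card_image_dilNode (k : ℕ) :
    ((Finset.range (2 ^ k)).image (dilNode k)).card = 2 ^ k := by
  rw [Finset.card_image_of_injOn (fun i hi j hj h => dilNode_injOn k ?_ ?_ h), Finset.card_range]
  · simpa using hi
  · simpa using hj

/-- **`¬ SeparatedRealZeroTauBound c` for every `c`** (integer dilation of the Chebyshev witness):
`E_{k,k} = a^{2^k} D_{2^k}(X/a)`, `a = 2^{2^k}`, is monic with `τ ≤ k(2k+7)` and has the `2^k`
real zeros `2a cos((2i+1)π/2^{k+1})`, pairwise at distance `≥ 8a/4^k ≥ 1`; `2^k > (11k²)^c ≥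
(τ + 2)^c` for `k` large. The undilated example is [cite: Koiran2011, §1 (p. 3)]; the dilation is
this audit's. [folklore] -/
theorem not_separatedRealZeroTauBound (c : ℕ) : ¬ SeparatedRealZeroTauBound c := by
  intro hc
  obtain ⟨T₀, hT⟩ := eventually_mul_pow_lt_two_pow (2 * c) (11 ^ c)
  set k : ℕ := max T₀ 1 with hk
  have hk1 : 1 ≤ k := le_max_right _ _
  have hlt : 11 ^ c * k ^ (2 * c) < 2 ^ k := hT k (le_max_left _ _)
  have h := hc (dilDickson k k) (dilDickson_ne_zero k) ((Finset.range (2 ^ k)).image (dilNode k))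
    (fun x hx => by
      obtain ⟨i, -, rfl⟩ := Finset.mem_image.mp hx
      exact isRoot_dilDickson_dilNode k i)
    (fun x hx y hy hxy => by
      obtain ⟨i, hi, rfl⟩ := Finset.mem_image.mp hx
      obtain ⟨i', hi', rfl⟩ := Finset.mem_image.mp hy
      exact one_le_abs_dilNode_sub (Finset.mem_range.mp hi) (Finset.mem_range.mp hi')
        (fun h => hxy (by rw [h])))
  rw [card_image_dilNode] at h
  have hτ := constantFreeComplexity_dilDickson_le k k
  have h2 : (constantFreeComplexity ((MvPolynomial.uniqueAlgEquiv ℤ (Fin 1)).symm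
      (dilDickson k k)) + 2) ^ c ≤ (11 * k ^ 2) ^ c :=
    Nat.pow_le_pow_left (by nlinarith) c
  rw [mul_pow, ← pow_mul] at h2
  omega

/-- Quantitative form: for every `c` an explicit nonzero `f` and a `1`-separated set of real zeros
of `f` with more than `(τ(f) + 2)^c` elements. [folklore] -/
theorem exists_separated_realRoots_gt_pow (c : ℕ) :
    ∃ f : Polynomial ℤ, f ≠ 0 ∧ ∃ S : Finset ℝ,
      (∀ x ∈ S, (f.map (Int.castRingHom ℝ)).IsRoot x) ∧
      (S : Set ℝ).Pairwise (fun x y => 1 ≤ |x - y|) ∧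
      (constantFreeComplexity ((MvPolynomial.uniqueAlgEquiv ℤ (Fin 1)).symm f) + 2) ^ c <
        S.card := by
  by_contra h
  push Not at h
  exact not_separatedRealZeroTauBound c (fun f hf S hS hsep => h f hf S hS hsep)

end Literature.Barriers.ValiantsHypothesis
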